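import Literature.MathematicalPhysics.QuantumFieldTheory.Balaban1983to89.B9Cor35GCubeInputsAtOne
import Literature.MathematicalPhysics.QuantumFieldTheory.Balaban1983to89.B9Eq383CubeLetters
import Literature.MathematicalPhysics.QuantumFieldTheory.Balaban1983to89.B9SectBGpReadingsY

/-!
# `Balaban1983to89.B9Cor35GCubeAvgPiece` — [B9] (3.83) p. 407 FOR THE BOND-SECTOR CUBE LETTERS IN [4]'s BLOCK-MAJORANT CURRENCY: the averaging piece
# `Q*_□(1)a_□Q_□(1) − Q*_□(U′)a_□Q_□(U′)` of the (3.84) remainder `V = Δ_{a,□}(1) − Δ_{a,□}(U′)`, realified, HAS THE `P₂`-SHAPED MAJORANT `κ·((Lⁿη)²)⁻¹·e^{−δd}` over the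
# cube sequence's blocks — the third of the three inputs of the (3.85)-majorant `h385` of `B9Cor35GCubeInputsAtOne.gStep_cube` (r06's `B9Ineq385VG.ineq385_op`, binder
# `hP₂`), from r05's pointwise (3.83) `B9Eq383CubeLetters` re-run with the averaging range and the smallness read PER INDEX BOND (sub-row G-B9-LETTERS, module M5.1b-G, FILE G-F5c)

T. Bałaban, *Propagators for lattice gauge theories in a background field*, Commun. Math. Phys. **99** (1985) 389–434
[`Balaban1985BackgroundPropagators`, "B9"]; [3] = T. Bałaban, *Propagators and renormalization transformations for lattice gauge theories. I*,
Commun. Math. Phys. **95** (1984) 17–40 [`Balaban1984PropagatorsI`]; [4] = part II, Commun. Math. Phys. **96** (1984) 223–250 [`Balaban1984PropagatorsII`].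

statement-level skeleton of published theorems with citation tags; proofs where landed; nothing here is a claim about the
Yang–Mills mass gap

THE PRINTED LOCUS (verbatim, held `paper:balaban1985-cmp99-background-propagators`, journal page = PDF page + 388; page owner r06).  p. 407: *«The operator P₂(A) is
a sum of three terms obtained by the expansion of averaging operators. It is a semi-local operator in the sense that the value (P₂(A)A′)(b) at a bond b ∈ B_j(Λ_j)
depends on A, A′ restricted to j-blocks neighbouring the block containing the bond b. It satisfies the bound |(P₂(A)A′)(b)| ≦ O(1)α₁(Lʲη)⁻²|A′|, b ∈ B_j(Λ_j),
(3.83) with the norm |A′| restricted to the blocks defined above … Using the bounds (3.73), (3.77), (3.83) and assuming that Theorem 3.3 holds for G(U), we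
get |(V(A)G(U)J)(b)| ≦ O(1)α₁e^{−(1/2)δ₀d(y,y′)}|J| … (3.85)»*; p. 406 (3.80)–(3.81): *«Q_j(U′U) = Q_j(U) + F_{2,j}(A) … |F_{2,j}(A; y, x)| ≦ O(1)α₁ … with a constant
O(1) depending on d and L only»*; (3.37) p. 396 (*«|A(b)| < α₁(Lʲη)⁻¹ for b ⊂ Ω_j»* — the smallness of `U′ = e^{iηA}` level by level); (3.40) p. 397 (*«Γ_{x,x′}
is a shortest contour»*); (3.13)–(3.15) pp. 392–393 (the averaging operators); (3.26) p. 395 (`Q*aQ` in `Δ_a`); p. 409 l. 1–5 (the cube operators).  [3] (1.18)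
p. 20 (the straight-contour average: range `< 2Lʲ`, unit rows); [4] (2.16) p. 225, (2.20) p. 226 (the weights `a_j(Lʲη)⁻²` and the volume-normalised averaging
kernel), (2.2)–(2.4) p. 224 (the level geometry), (2.46) p. 231, (2.51) p. 232 (block distance and block majorants).

WHY THIS FILE (cell `lit-balaban`, sub-row G-B9-LETTERS; module M5.1b-G, FILE G-F5c; after G-F4 `B9Cor35GCubeInputsAtOne` p643492 ✓).  `gStep_cube` reduced Cor. 3.5
for the bond-sector cube letter (`IsUnit Δ_{a,□}(Ṽ_□)` + the left (3.42)-entries of `G_□(Ṽ_□)`) to ONE analytic input, the (3.85)-majorant of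
`conj b(Δ_{a,□}(1) − Δ_{a,□}(Ṽ_□))·conj b(G_□(1))`, which r06's letter-free `ineq385_op` produces from (3.73)∕(3.77)∕(3.83)-SHAPED majorants of the three pieces of
the remainder.  THIS FILE delivers the AVERAGING piece (the `hP₂` binder: `P₂ ≺ κ₂α₁(len)⁻²e^{−δd}`) at r05's cube letters `QCubeY ∕ QsCubeY ∕ aCubeY` with def-Y's
taxicab transporters `parBY`.  r05's `B9Eq383CubeLetters` proves (3.83) POINTWISE with ONE averaging range `D` and ONE smallness `ρ` for all index bonds (its
`(1 + Dρ)`, `Dρ` then carry the member's top range `(d+2)(Lᵏ − 1)`); print's `O(1)α₁` is LEVEL BY LEVEL — `|U′U(Γ) − U(Γ)| ≦ |Γ|·sup|ηA| ≦ (d+2)Lʲ·α₁L^{−j}`.  So §1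
re-runs r05's short chain (same lemmas BY NAME: `norm_trLiftY_sub_apply_le`, `norm_qTc_mul_sub_le`, `unitaryLike_qTc_parBY`, `norm_inv_sub_inv_le`,
`mul_norm_QCubeY_apply_le`, `apply_sub_apply_eq_three_terms`) with the range `Da(ι)` and the smallness `ρ(ι)` read PER INDEX BOND and only the product
`Da(ι)ρ(ι) ≤ τ` uniform; §2 collects the V1 lineage's geometry of the double support (level window, `d ≤ ℓ + 3` to the carrier block, weights against plateaus);
§3 is the block bound on product inputs; §4 the [4] (2.51) majorant through n06-c's reading-to-majorant lemma.

WHAT THIS FILE PROVES (THEOREMS + two `def`s with bodies: the real constant `kappaAv`, the realified piece `avgPieceK`; 0 `def … : Prop`, 0 sorry).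
* §1 ★ `norm_QCubeY_mul_sub_apply_le_at` ((3.81) for `Q_□`, range of the index bond at hand: `≤ 2(Da·ρ)Σ_b|q_□(ι,b)|‖A(b)‖`), ★ `norm_QsCubeY_mul_sub_apply_le_at` ((3.81) for
  `Q*_□`, per-index-bond `Da(ι), ρ(ι)` with `Da(ι)ρ(ι) ≤ τ`: `≤ 2τΣ_ι|q*_□(b,ι)|‖B(ι)‖`), `mul_norm_F2_apply_le_at`, ★★ `norm_QsaQCubeY_mul_sub_apply_le_at` ((3.83) pointwise:
  `‖(Q*_□(U′U)a_□Q_□(U′U)A − Q*_□(U)a_□Q_□(U)A)(b)‖ ≤ 4τ(1 + τ)·P·Σ_ι|q*_□(b,ι)|`, `P` the level-weighted amplitude bound on the double support), ★★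
  `norm_QsaQCubeY_sub_one_apply_le_at` (background `1`).  r05's uniform-range statements are the case `Da(ι) := D`, `ρ(ι) := ρ`, `τ := Dρ`.
* §2 `blkV1_level`, ★ `lvl_window` (`q_□(ι,f) ≠ 0 ⟹ J − 1 ≤ n(y(f)) ≤ J`, V1's `lev_ends_bounds`), ★ `dist_beta_blkV1_le` (`d(β(ι), y(f)) ≤ ℓ + 3`, V1's `geomT_dist_ends_le`),
  ★ `dist_blkV1_le_of_common` (two fine bonds seen by one index bond: `d ≤ 2ℓ + 6`), `wCubeBond_le` (`w_□(ι) ≤ b₁(c_f∕Lᴶ)²L^{J(d+1)}`), ★ `sum_qKc_col_le_plateau`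
  (`Σ_ι q_□(ι,f) ≤ 2L^{−n(d+1)}`: only the levels `n, n+1` see `f`, r05's `sum_qKc_lvl_le` per level).
* §3 `kappaAv d ℓ b₁ α₁ δ = 8(d+2)α₁(1 + (d+2)α₁)·b₁L^{d+1}·e^{δ(2ℓ+6)}`, `kappaAv_nonneg`, `cf_div_pow_sq` (`(c_f∕Lⁿ)² = ((Lⁿη)²)⁻¹`), ★★★ `norm_avgPiece_liftY_apply_le` — for
  unitary-like `U′` with `‖U′ − 1‖ ≤ α₁L^{−J}` within `(d+2)(Lᴶ − 1)` of every level-`J` base point (DISPLAYED), `g ⊗ E` supported in the block `y′`, `|g| ≤ B`,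
  `‖E‖ ≤ 1`, `δ ≥ 0`: `‖((Q*_□(U′)a_□Q_□(U′) − Q*_□(1)a_□Q_□(1))(g ⊗ E))(b)‖ ≤ κ_av·((Lⁿη)²)⁻¹·e^{−δd(y(b),y′)}·B` (ranges `Da(ι) = (d+2)(Lᴶ − 1)` by r05's
  `tdist_of_qKc_ne_zero`, `ρ(ι) = α₁L^{−J}`, `τ = (d+2)α₁`; the weight of every contributing `ι` against `(c_f∕Lⁿ)²L^{(n+1)(d+1)}` by the level window at `b`; the
  column sum against `2L^{−n(d+1)}`; locality `e^{δ(2ℓ+6)}e^{−δd} ≥ 1` on the double support).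
* §4 `avgPieceK b i □ V := conj b(Q*_□(1)a_□Q_□(1) − Q*_□(V)a_□Q_□(V))`, ★★★ `hasMajorant_avgPieceK` — `avgPieceK ≺ (M₂Σ_j‖b_j‖)·κ_av·((Lⁿη)²)⁻¹·e^{−δd}` over
  `toB6 (geoCK i □) Rr H` with G-F4's bond block map `blkBK` (n06-c's `B9SectBGpReadingsY.hasMajorant_conj_of_liftY_bound`).

HONEST SCOPE.  Finite lattice algebra over landed letters; nothing of [B9]'s analysis ((3.78), [5] (143)) is asserted or used.  DISPLAYED: the level-by-level smallness
of `U′` on the averaging stencils (print's (3.37) in the gauge of Cor. 3.6; on the cube road `U′ = Ṽ_□ = e^{iηχ̃_□A}` — the bridge from p33's `Reg335Cube` datum ∕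
`readings337_locFld` to this ι-centred form is NOT done here), unitary-likeness of `U′`, the weight band `0 < b₀ ≤ b₁`, the coordinate constant `M₂` of the real
basis.  Print's `O(1)α₁(Lʲη)⁻²` is `κ_av·((Lⁿη)²)⁻¹` with `n` the level of the OUTPUT bond's cube block and `κ_av` explicit (depending on `d, L, b₁, δ` and
polynomially on `α₁`); the rate `δ` is free (the semi-local support costs `e^{δ(2ℓ+6)}`).  The Laplacian piece (3.69)–(3.73) and the projection piece (3.74)–(3.77)
of `h385` are NOT treated (FILES G-F5a∕b).  Count-neutral; NOT a node discharge; no summit ∕ sub-problem statement is proved; nothing continuum ∕ OS ∕ mass-gap ∕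
Clay; YM mass gap NOT proved by any of this (Track A conditional rung).  No `sorry`, no `axiom`, no `… : Prop` fact, no `instance`, no `notation`.  NEW file;
nothing landed is modified.  Cell `lit-balaban`, seat `lit-balaban-p38` gen 42, 2026-08-28; `--supports stmt-QuantumFields-19200` as helper.
Net new unproved facts: 0.

RELATED IN THE TREE, NOT DUPLICATED: r05's `B9Eq380CubeLetters` ∕ `B9Eq383CubeLetters` (uniform-range pointwise and `L²` forms — the special case of §1; USED BY NAME
for every ingredient); ym-inputs-p02's `B9Eq382CubeLetters` (the `L²` assembly); r06's `B9Ineq385VG.ineq383_op` (the abstract `P₂` composition from `F₂`-letter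
majorants — an alternative road needing block majorants of `Q_□`, `Q*_□`, `F₂`, `F₂*` separately; not taken).
-/

noncomputable section

namespace Literature.MathematicalPhysics.QuantumFieldTheory.Balaban1983to89.B9Cor35GCubeAvgPiece

open LatticeFieldCalculus
open Node00
open Literature.MathematicalPhysics.QuantumFieldTheory.Balaban1983to89
open Literature.MathematicalPhysics.QuantumFieldTheory.Balaban1983to89.B9Eq39Adjoint (R)
open Literature.MathematicalPhysics.QuantumFieldTheory.Balaban1983to89.T4RelativeLadder (UnitaryLike norm_inv_sub_inv_le)
open Literature.MathematicalPhysics.QuantumFieldTheory.Balaban1983to89.B6KLevelCensusIndexV1 (KIdx kGeo)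
open Literature.MathematicalPhysics.QuantumFieldTheory.Balaban1983to89.B6Cover236MultiLevelBlocks (cubes)
open Literature.MathematicalPhysics.QuantumFieldTheory.Balaban1983to89.B6GlobalChartV1 (PV)
open Literature.MathematicalPhysics.QuantumFieldTheory.Balaban1983to89.B15DeterminingSets (embIter)
open Literature.MathematicalPhysics.QuantumFieldTheory.Balaban1983to89.B9CubeLettersOpsL0 (cubeFamY levCubeY)
open Literature.MathematicalPhysics.QuantumFieldTheory.Balaban1983to89.B9CubeLettersBondOpsL0 (IBondCubeY BlkCubeY qKc qsKc qTc aCubeY QCubeY QsCubeY)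
open Literature.MathematicalPhysics.QuantumFieldTheory.Balaban1983to89.B9CubeBondWeights (wCubeBond wCubeBond_pos)
open Literature.MathematicalPhysics.QuantumFieldTheory.Balaban1983to89.B9CubeLettersCovarianceL0 (qsKc_eq_transpose)
open Literature.MathematicalPhysics.QuantumFieldTheory.Balaban1983to89.B9Eq380CubeLetters (unitaryLike_qTc_parBY norm_qTc_mul_sub_le norm_trLiftY_sub_apply_le
  tdist_of_qKc_ne_zero mul_one_cfg)
open Literature.MathematicalPhysics.QuantumFieldTheory.Balaban1983to89.B9Eq383CubeLetters (apply_sub_apply_eq_three_terms mul_norm_QCubeY_apply_le sum_abs_qKc_eq_one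
  norm_aCubeY_apply qKc_nonneg sum_qKc_lvl_le wCubeBond_mul_plateau_le)
open Literature.MathematicalPhysics.QuantumFieldTheory.Balaban1983to89.B9Eq3104CutoffCommutators (norm_trLiftY_apply_le)
open Literature.MathematicalPhysics.QuantumFieldTheory.Balaban1983to89.B3TorusRadialSums (supDist_le_tdist)
open Literature.MathematicalPhysics.QuantumFieldTheory.Balaban1983to89.B6GlobalChartV1L0 (blkV1)
open Literature.MathematicalPhysics.QuantumFieldTheory.Balaban1983to89.B9CubeGeometryInputs (geoCK geoCK_len geoCK_dist)
open scoped Matrix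

variable {d ℓ : ℕ} {hd : 1 ≤ d + 1} {hL : Odd (ℓ + 1) ∧ 1 < ℓ + 1} {b₀ b₁ : ℝ}

/-! ## §1  (3.80)–(3.83) at the cube letters WITH THE AVERAGING RANGE AND THE SMALLNESS READ PER INDEX BOND (`|Γ_ι|·ρ_ι ≤ τ`) — r05's `B9Eq380∕383CubeLetters`
chain re-run with `τ` in place of `D·ρ` (print: `|U′U(Γ) − U(Γ)| ≤ |Γ|·sup|ηA| = O(1)α₁` level by level) -/

section PerIndexBond

variable {𝔸 : Type} [NormedRing 𝔸] [NormedAlgebra ℂ 𝔸] [CompleteSpace 𝔸] [NormOneClass 𝔸]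
variable (i : KIdx d ℓ hd hL b₀ b₁) (q : ↥(cubes (toKT i).D.toDomains))

/-- ★ **(3.80)–(3.81) FOR `Q_□`, POINTWISE, RANGE AND SMALLNESS OF THE INDEX BOND AT HAND**: for unitary-like `U, U′`, a range `Da` of the index bond `ι`
(`q_□(ι,b) ≠ 0 ⟹ |x(ι) − b₋|₁ ≤ Da`) and `‖U′ − 1‖ ≤ ρ` on the bonds sourced within `ℓ^∞`-distance `Da` of `x(ι)`:
`‖(Q_□(U′U)A − Q_□(U)A)(ι)‖ ≤ 2·(Da·ρ)·Σ_b |q_□(ι,b)|·‖A(b)‖` (r05's `norm_QCubeY_mul_sub_apply_le` with its range hypothesis asked for `ι` only).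
[cite: Balaban1985BackgroundPropagators, (3.80)–(3.81) pp.406–407, (3.13)–(3.15) pp.392–393, (3.40) p.397, p.409 l.3–5] -/
theorem norm_QCubeY_mul_sub_apply_le_at {U V : CfgY 𝔸 i} (hU : ∀ μ x, UnitaryLike (U μ x)) (hV : ∀ μ x, UnitaryLike (V μ x)) {ρ : ℝ} (hρ : 0 ≤ ρ)
    (ι : IBondCubeY i q) {Da : ℕ} (hDa : ∀ b : FBondY i, qKc i q ι b ≠ 0 → Site.tdist (embIter (ι.1.1 : ℕ) ι.1.2.src) b.src ≤ Da)
    (hsmall : ∀ (ν : Fin (d + 1)) (w : Site (PV d ℓ i.m i.K hd hL) 0), supDist (embIter (ι.1.1 : ℕ) ι.1.2.src) w ≤ Da → ‖(V ν w : 𝔸) - 1‖ ≤ ρ)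
    (A : FBondY i → 𝔸) :
    ‖(QCubeY i q (parBY i) (fun μ x => V μ x * U μ x) A - QCubeY i q (parBY i) U A) ι‖ ≤ 2 * ((Da : ℝ) * ρ) * ∑ b, |qKc i q ι b| * ‖A b‖ := by
  have h := norm_trLiftY_sub_apply_le (qKc i q) (qTc i q (parBY i) (fun μ x => V μ x * U μ x)) (qTc i q (parBY i) U) A ι (τ := fun _ => Da * ρ)
    (fun b _ => unitaryLike_qTc_parBY i q (fun μ x => (hV μ x).mul (hU μ x)) ι b) (fun b _ => unitaryLike_qTc_parBY i q hU ι b)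
    (fun b hb => by
      have hD := hDa b hb
      refine (norm_qTc_mul_sub_le i q hU hV hρ ι b fun ν w hw => hsmall ν w ?_).trans ?_
      · exact hw.trans ((supDist_le_tdist _ _).trans hD)
      · exact mul_le_mul_of_nonneg_right (by exact_mod_cast hD) hρ)
  refine h.trans (le_of_eq ?_)
  rw [Finset.mul_sum]
  exact Finset.sum_congr rfl fun b _ => by ring

/-- ★ **(3.80)–(3.81) FOR `Q*_□`, POINTWISE, PER-INDEX-BOND RANGES `Da(ι)`, SMALLNESS `ρ(ι)` AND A COMMON BOUND `τ` ON `Da(ι)·ρ(ι)`** over the index bonds seeing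
the fine bond `b`: `‖(Q*_□(U′U)B − Q*_□(U)B)(b)‖ ≤ 2τ·Σ_ι |q*_□(b,ι)|·‖B(ι)‖`. [cite: Balaban1985BackgroundPropagators, (3.80)–(3.81) pp.406–407, (3.13) p.392, p.409 l.3–5] -/
theorem norm_QsCubeY_mul_sub_apply_le_at {U V : CfgY 𝔸 i} (hU : ∀ μ x, UnitaryLike (U μ x)) (hV : ∀ μ x, UnitaryLike (V μ x))
    {ρ : IBondCubeY i q → ℝ} (hρ : ∀ ι, 0 ≤ ρ ι) {Da : IBondCubeY i q → ℕ} {τ : ℝ}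
    (hDa : ∀ (ι : IBondCubeY i q) (b' : FBondY i), qKc i q ι b' ≠ 0 → Site.tdist (embIter (ι.1.1 : ℕ) ι.1.2.src) b'.src ≤ Da ι) (b : FBondY i)
    (hsmall : ∀ ι : IBondCubeY i q, qsKc i q b ι ≠ 0 → ∀ (ν : Fin (d + 1)) (w : Site (PV d ℓ i.m i.K hd hL) 0),
      supDist (embIter (ι.1.1 : ℕ) ι.1.2.src) w ≤ Da ι → ‖(V ν w : 𝔸) - 1‖ ≤ ρ ι)
    (hprod : ∀ ι : IBondCubeY i q, qsKc i q b ι ≠ 0 → (Da ι : ℝ) * ρ ι ≤ τ) (B : IBondCubeY i q → 𝔸) :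
    ‖(QsCubeY i q (parBY i) (fun μ x => V μ x * U μ x) B - QsCubeY i q (parBY i) U B) b‖ ≤ 2 * τ * ∑ ι, |qsKc i q b ι| * ‖B ι‖ := by
  have hVU : ∀ μ x, UnitaryLike (V μ x * U μ x) := fun μ x => (hV μ x).mul (hU μ x)
  have h := norm_trLiftY_sub_apply_le (qsKc i q) (fun b ι => (qTc i q (parBY i) (fun μ x => V μ x * U μ x) ι b)⁻¹)
    (fun b ι => (qTc i q (parBY i) U ι b)⁻¹) B b (τ := fun _ => τ)
    (fun ι _ => (unitaryLike_qTc_parBY i q hVU ι b).inv) (fun ι _ => (unitaryLike_qTc_parBY i q hU ι b).inv)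
    (fun ι hι => by
      have hι' : qKc i q ι b ≠ 0 := by rwa [qsKc_eq_transpose, Matrix.transpose_apply] at hι
      have hD := hDa ι b hι'
      refine (norm_inv_sub_inv_le (unitaryLike_qTc_parBY i q hVU ι b) (unitaryLike_qTc_parBY i q hU ι b)).trans ?_
      refine (norm_qTc_mul_sub_le i q hU hV (hρ ι) ι b fun ν w hw => hsmall ι hι ν w ?_).trans ?_
      · exact hw.trans ((supDist_le_tdist _ _).trans hD)
      · exact (mul_le_mul_of_nonneg_right (by exact_mod_cast hD) (hρ ι)).trans (hprod ι hι))
  show ‖(QsCubeY i q (parBY i) (fun μ x => V μ x * U μ x) B - QsCubeY i q (parBY i) U B) b‖ ≤ _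
  refine h.trans (le_of_eq ?_)
  rw [Finset.mul_sum]
  exact Finset.sum_congr rfl fun ι _ => by ring

/-- ★ **THE WEIGHTED SIZE OF ONE EXPANDED AVERAGE, RANGE OF THE INDEX BOND AT HAND**: `w_□(ι)·‖(F₂A)(ι)‖ ≤ 2(Da·ρ)·P` when `w_□(ι)·‖A(f)‖ ≤ P` on the row of `ι`.
[cite: Balaban1985BackgroundPropagators, (3.80)–(3.81) pp.406–407, (3.83) p.407] -/
theorem mul_norm_F2_apply_le_at (hb₀ : 0 < b₀) {U V : CfgY 𝔸 i} (hU : ∀ μ x, UnitaryLike (U μ x)) (hV : ∀ μ x, UnitaryLike (V μ x)) {ρ : ℝ} (hρ : 0 ≤ ρ)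
    (A : FBondY i → 𝔸) (ι : IBondCubeY i q) {Da : ℕ} (hDa : ∀ b : FBondY i, qKc i q ι b ≠ 0 → Site.tdist (embIter (ι.1.1 : ℕ) ι.1.2.src) b.src ≤ Da)
    (hsmall : ∀ (ν : Fin (d + 1)) (w : Site (PV d ℓ i.m i.K hd hL) 0), supDist (embIter (ι.1.1 : ℕ) ι.1.2.src) w ≤ Da → ‖(V ν w : 𝔸) - 1‖ ≤ ρ)
    {P : ℝ} (hA : ∀ f, qKc i q ι f ≠ 0 → wCubeBond i q ι * ‖A f‖ ≤ P) :
    wCubeBond i q ι * ‖(QCubeY i q (parBY i) (fun μ x => V μ x * U μ x) A - QCubeY i q (parBY i) U A) ι‖ ≤ 2 * ((Da : ℝ) * ρ) * P := by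
  have hw : 0 ≤ wCubeBond i q ι := (wCubeBond_pos i q hb₀ ι).le
  have hD : (0 : ℝ) ≤ 2 * ((Da : ℝ) * ρ) := by positivity
  have e := norm_QCubeY_mul_sub_apply_le_at i q hU hV hρ ι hDa hsmall A
  calc wCubeBond i q ι * ‖(QCubeY i q (parBY i) (fun μ x => V μ x * U μ x) A - QCubeY i q (parBY i) U A) ι‖
      ≤ wCubeBond i q ι * (2 * ((Da : ℝ) * ρ) * ∑ f, |qKc i q ι f| * ‖A f‖) := mul_le_mul_of_nonneg_left e hw
    _ = 2 * ((Da : ℝ) * ρ) * ∑ f, |qKc i q ι f| * (wCubeBond i q ι * ‖A f‖) := by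
        rw [Finset.mul_sum, Finset.mul_sum, Finset.mul_sum]; exact Finset.sum_congr rfl fun f _ => by ring
    _ ≤ 2 * ((Da : ℝ) * ρ) * ∑ f, |qKc i q ι f| * P := by
        refine mul_le_mul_of_nonneg_left (Finset.sum_le_sum fun f _ => ?_) hD
        by_cases hq : qKc i q ι f = 0
        · rw [hq, abs_zero, zero_mul, zero_mul]
        · exact mul_le_mul_of_nonneg_left (hA f hq) (abs_nonneg _)
    _ = 2 * ((Da : ℝ) * ρ) * P := by rw [← Finset.sum_mul, sum_abs_qKc_eq_one, one_mul]

/-- ★★ **(3.83) AT THE CUBE LETTERS, POINTWISE, PER-INDEX-BOND RANGE AND SMALLNESS** (r05's `norm_QsaQCubeY_mul_sub_apply_le_ofRange` with `(Da, ρ)` read per index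
bond and only the product `Da(ι)·ρ(ι) ≤ τ` uniform — print's level-by-level `|Γ|·sup|ηA| ≦ (d+2)Lʲ·α₁L^{−j} = O(1)α₁`): for unitary-like `U, U′`, the averaging
ranges `Da(ι)`, `‖U′ − 1‖ ≤ ρ(ι)` within `ℓ^∞`-distance `Da(ι)` of `x(ι)` for the index bonds seeing `b`, `Da(ι)ρ(ι) ≤ τ`, and the LEVEL-WEIGHTED amplitude
bound `w_□(ι)·‖A(f)‖ ≤ P` on the double support: `‖(Q*_□(U′U)a_□Q_□(U′U)A − Q*_□(U)a_□Q_□(U)A)(b)‖ ≤ 4τ(1 + τ)·P·Σ_ι |q*_□(b, ι)|`.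
[cite: Balaban1985BackgroundPropagators, (3.82)–(3.83) p.407, (3.80)–(3.81) pp.406–407, (3.26) p.395, p.409 l.1–5] -/
theorem norm_QsaQCubeY_mul_sub_apply_le_at (hb₀ : 0 < b₀) {U V : CfgY 𝔸 i} (hU : ∀ μ x, UnitaryLike (U μ x)) (hV : ∀ μ x, UnitaryLike (V μ x))
    {ρ : IBondCubeY i q → ℝ} (hρ : ∀ ι, 0 ≤ ρ ι) {Da : IBondCubeY i q → ℕ} {τ : ℝ} (hτ : 0 ≤ τ)
    (hDa : ∀ (ι : IBondCubeY i q) (b' : FBondY i), qKc i q ι b' ≠ 0 → Site.tdist (embIter (ι.1.1 : ℕ) ι.1.2.src) b'.src ≤ Da ι) (b : FBondY i)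
    (hsmall : ∀ ι : IBondCubeY i q, qsKc i q b ι ≠ 0 → ∀ (ν : Fin (d + 1)) (w : Site (PV d ℓ i.m i.K hd hL) 0),
      supDist (embIter (ι.1.1 : ℕ) ι.1.2.src) w ≤ Da ι → ‖(V ν w : 𝔸) - 1‖ ≤ ρ ι)
    (hprod : ∀ ι : IBondCubeY i q, qsKc i q b ι ≠ 0 → (Da ι : ℝ) * ρ ι ≤ τ)
    (A : FBondY i → 𝔸) {P : ℝ} (hA : ∀ (ι : IBondCubeY i q) (f : FBondY i), qsKc i q b ι ≠ 0 → qKc i q ι f ≠ 0 → wCubeBond i q ι * ‖A f‖ ≤ P) :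
    ‖(QsCubeY i q (parBY i) (fun μ x => V μ x * U μ x) (aCubeY i q (QCubeY i q (parBY i) (fun μ x => V μ x * U μ x) A)) -
        QsCubeY i q (parBY i) U (aCubeY i q (QCubeY i q (parBY i) U A))) b‖ ≤
      4 * τ * (1 + τ) * P * ∑ ι, |qsKc i q b ι| := by
  set X₀ : IBondCubeY i q → 𝔸 := aCubeY i q (QCubeY i q (parBY i) U A) with hX₀
  set X₁ : IBondCubeY i q → 𝔸 := aCubeY i q (QCubeY i q (parBY i) (fun μ x => V μ x * U μ x) A) with hX₁
  -- the weighted sizes of `X₀ = a_□Q_□(U)A` and of `X₁ − X₀ = a_□F₂A` on the index bonds seeing `b`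
  have hX0 : ∀ ι, qsKc i q b ι ≠ 0 → ‖X₀ ι‖ ≤ P := by
    intro ι hι
    rw [hX₀, norm_aCubeY_apply i q hb₀]
    exact mul_norm_QCubeY_apply_le i q hb₀ hU A ι (fun f hf => hA ι f hι hf)
  have hX10 : X₁ - X₀ = aCubeY i q (QCubeY i q (parBY i) (fun μ x => V μ x * U μ x) A - QCubeY i q (parBY i) U A) := by
    rw [hX₁, hX₀, map_sub]
  have hX1 : ∀ ι, qsKc i q b ι ≠ 0 → ‖(X₁ - X₀) ι‖ ≤ 2 * τ * P := by
    intro ι hι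
    rw [hX10, norm_aCubeY_apply i q hb₀]
    have hP0 : 0 ≤ P := by
      obtain ⟨f, -, hf⟩ := Finset.exists_ne_zero_of_sum_ne_zero (by rw [sum_abs_qKc_eq_one i q ι]; exact one_ne_zero)
      have hf' : qKc i q ι f ≠ 0 := fun h => hf (by rw [h, abs_zero])
      exact le_trans (mul_nonneg (wCubeBond_pos i q hb₀ ι).le (norm_nonneg _)) (hA ι f hι hf')
    refine (mul_norm_F2_apply_le_at i q hb₀ hU hV (hρ ι) A ι (hDa ι) (hsmall ι hι) (fun f hf => hA ι f hι hf)).trans ?_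
    have := hprod ι hι
    nlinarith
  -- the three terms of (3.82)
  have hsplit := apply_sub_apply_eq_three_terms (QsCubeY i q (parBY i) U) (QsCubeY i q (parBY i) (fun μ x => V μ x * U μ x)) X₀ X₁
  have happ := congrArg (fun g : FBondY i → 𝔸 => g b) hsplit
  simp only [Pi.add_apply, Pi.sub_apply] at happ
  have hT1 : ‖QsCubeY i q (parBY i) (fun μ x => V μ x * U μ x) X₀ b - QsCubeY i q (parBY i) U X₀ b‖ ≤ 2 * τ * (P * ∑ ι, |qsKc i q b ι|) := by
    have e := norm_QsCubeY_mul_sub_apply_le_at i q hU hV hρ hDa b hsmall hprod X₀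
    rw [Pi.sub_apply] at e
    have hterm : ∑ ι, |qsKc i q b ι| * ‖X₀ ι‖ ≤ ∑ ι, |qsKc i q b ι| * P :=
      Finset.sum_le_sum fun ι _ => by
        by_cases hι : qsKc i q b ι = 0
        · rw [hι, abs_zero, zero_mul, zero_mul]
        · exact mul_le_mul_of_nonneg_left (hX0 ι hι) (abs_nonneg _)
    rw [← Finset.sum_mul] at hterm
    calc _ ≤ 2 * τ * ∑ ι, |qsKc i q b ι| * ‖X₀ ι‖ := e
      _ ≤ 2 * τ * ((∑ ι, |qsKc i q b ι|) * P) := mul_le_mul_of_nonneg_left hterm (by positivity)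
      _ = 2 * τ * (P * ∑ ι, |qsKc i q b ι|) := by ring
  have hT2 : ‖QsCubeY i q (parBY i) U (X₁ - X₀) b‖ ≤ 2 * τ * (P * ∑ ι, |qsKc i q b ι|) := by
    have e : ‖QsCubeY i q (parBY i) U (X₁ - X₀) b‖ ≤ ∑ ι, |qsKc i q b ι| * ‖(X₁ - X₀) ι‖ :=
      norm_trLiftY_apply_le (qsKc i q) (fun b ι => ⟨(unitaryLike_qTc_parBY i q hU ι b).2, by
        rw [inv_inv]; exact (unitaryLike_qTc_parBY i q hU ι b).1⟩) (X₁ - X₀) b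
    have hterm : ∑ ι, |qsKc i q b ι| * ‖(X₁ - X₀) ι‖ ≤ ∑ ι, |qsKc i q b ι| * (2 * τ * P) :=
      Finset.sum_le_sum fun ι _ => by
        by_cases hι : qsKc i q b ι = 0
        · rw [hι, abs_zero, zero_mul, zero_mul]
        · exact mul_le_mul_of_nonneg_left (hX1 ι hι) (abs_nonneg _)
    rw [← Finset.sum_mul] at hterm
    calc _ ≤ ∑ ι, |qsKc i q b ι| * ‖(X₁ - X₀) ι‖ := e
      _ ≤ (∑ ι, |qsKc i q b ι|) * (2 * τ * P) := hterm
      _ = 2 * τ * (P * ∑ ι, |qsKc i q b ι|) := by ring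
  have hT3 : ‖QsCubeY i q (parBY i) (fun μ x => V μ x * U μ x) (X₁ - X₀) b - QsCubeY i q (parBY i) U (X₁ - X₀) b‖ ≤
      2 * τ * (2 * τ * (P * ∑ ι, |qsKc i q b ι|)) := by
    have e := norm_QsCubeY_mul_sub_apply_le_at i q hU hV hρ hDa b hsmall hprod (X₁ - X₀)
    rw [Pi.sub_apply] at e
    have hterm : ∑ ι, |qsKc i q b ι| * ‖(X₁ - X₀) ι‖ ≤ ∑ ι, |qsKc i q b ι| * (2 * τ * P) :=
      Finset.sum_le_sum fun ι _ => by
        by_cases hι : qsKc i q b ι = 0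
        · rw [hι, abs_zero, zero_mul, zero_mul]
        · exact mul_le_mul_of_nonneg_left (hX1 ι hι) (abs_nonneg _)
    rw [← Finset.sum_mul] at hterm
    calc _ ≤ 2 * τ * ∑ ι, |qsKc i q b ι| * ‖(X₁ - X₀) ι‖ := e
      _ ≤ 2 * τ * ((∑ ι, |qsKc i q b ι|) * (2 * τ * P)) := mul_le_mul_of_nonneg_left hterm (by positivity)
      _ = 2 * τ * (2 * τ * (P * ∑ ι, |qsKc i q b ι|)) := by ring
  have hgoal : QsCubeY i q (parBY i) (fun μ x => V μ x * U μ x) X₁ b - QsCubeY i q (parBY i) U X₀ b =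
      (QsCubeY i q (parBY i) (fun μ x => V μ x * U μ x) X₀ b - QsCubeY i q (parBY i) U X₀ b) + QsCubeY i q (parBY i) U (X₁ - X₀) b +
        (QsCubeY i q (parBY i) (fun μ x => V μ x * U μ x) (X₁ - X₀) b - QsCubeY i q (parBY i) U (X₁ - X₀) b) := happ
  rw [Pi.sub_apply, hgoal]
  refine (norm_add_le _ _).trans ((add_le_add (norm_add_le _ _) le_rfl).trans ?_)
  have hsum : 0 ≤ P * ∑ ι, |qsKc i q b ι| := by
    by_cases hS : ∑ ι, |qsKc i q b ι| = 0
    · rw [hS, mul_zero]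
    · obtain ⟨ι, -, hι⟩ := Finset.exists_ne_zero_of_sum_ne_zero hS
      have hι' : qsKc i q b ι ≠ 0 := fun h => hι (by rw [h, abs_zero])
      obtain ⟨f, -, hf⟩ := Finset.exists_ne_zero_of_sum_ne_zero (by rw [sum_abs_qKc_eq_one i q ι]; exact one_ne_zero)
      have hf' : qKc i q ι f ≠ 0 := fun h => hf (by rw [h, abs_zero])
      have hP : 0 ≤ P := le_trans (mul_nonneg (wCubeBond_pos i q hb₀ ι).le (norm_nonneg _)) (hA ι f hι' hf')
      exact mul_nonneg hP (Finset.sum_nonneg fun ι _ => abs_nonneg _)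
  calc ‖QsCubeY i q (parBY i) (fun μ x => V μ x * U μ x) X₀ b - QsCubeY i q (parBY i) U X₀ b‖ + ‖QsCubeY i q (parBY i) U (X₁ - X₀) b‖ +
        ‖QsCubeY i q (parBY i) (fun μ x => V μ x * U μ x) (X₁ - X₀) b - QsCubeY i q (parBY i) U (X₁ - X₀) b‖
      ≤ 2 * τ * (P * ∑ ι, |qsKc i q b ι|) + 2 * τ * (P * ∑ ι, |qsKc i q b ι|) + 2 * τ * (2 * τ * (P * ∑ ι, |qsKc i q b ι|)) :=
        add_le_add (add_le_add hT1 hT2) hT3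
    _ = 4 * τ * (1 + τ) * P * ∑ ι, |qsKc i q b ι| := by ring

/-- ★★ **THE SAME ON THE CUBE ROAD** (background `1`, Cor. 3.6 p. 408): `‖(Q*_□(U′)a_□Q_□(U′)A − Q*_□(1)a_□Q_□(1)A)(b)‖ ≤ 4τ(1 + τ)·P·Σ_ι |q*_□(b, ι)|`.
[cite: Balaban1985BackgroundPropagators, (3.83) p.407, Cor. 3.5 p.407, Cor. 3.6 p.408] -/
theorem norm_QsaQCubeY_sub_one_apply_le_at (hb₀ : 0 < b₀) {V : CfgY 𝔸 i} (hV : ∀ μ x, UnitaryLike (V μ x))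
    {ρ : IBondCubeY i q → ℝ} (hρ : ∀ ι, 0 ≤ ρ ι) {Da : IBondCubeY i q → ℕ} {τ : ℝ} (hτ : 0 ≤ τ)
    (hDa : ∀ (ι : IBondCubeY i q) (b' : FBondY i), qKc i q ι b' ≠ 0 → Site.tdist (embIter (ι.1.1 : ℕ) ι.1.2.src) b'.src ≤ Da ι) (b : FBondY i)
    (hsmall : ∀ ι : IBondCubeY i q, qsKc i q b ι ≠ 0 → ∀ (ν : Fin (d + 1)) (w : Site (PV d ℓ i.m i.K hd hL) 0),
      supDist (embIter (ι.1.1 : ℕ) ι.1.2.src) w ≤ Da ι → ‖(V ν w : 𝔸) - 1‖ ≤ ρ ι)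
    (hprod : ∀ ι : IBondCubeY i q, qsKc i q b ι ≠ 0 → (Da ι : ℝ) * ρ ι ≤ τ)
    (A : FBondY i → 𝔸) {P : ℝ} (hA : ∀ (ι : IBondCubeY i q) (f : FBondY i), qsKc i q b ι ≠ 0 → qKc i q ι f ≠ 0 → wCubeBond i q ι * ‖A f‖ ≤ P) :
    ‖(QsCubeY i q (parBY i) V (aCubeY i q (QCubeY i q (parBY i) V A)) - QsCubeY i q (parBY i) 1 (aCubeY i q (QCubeY i q (parBY i) 1 A))) b‖ ≤
      4 * τ * (1 + τ) * P * ∑ ι, |qsKc i q b ι| := by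
  have h := norm_QsaQCubeY_mul_sub_apply_le_at i q hb₀ (U := 1) (fun _ _ => T4RelativeLadder.UnitaryLike.one) hV hρ hτ hDa b hsmall hprod A hA
  rwa [mul_one_cfg] at h

end PerIndexBond

/-! ## §2  The double support of the averaging piece: level window, weights, level sums, and block distance `≤ 2(ℓ + 3)` -/

section Support

variable (i : KIdx d ℓ hd hL b₀ b₁) (q : ↥(cubes (toKT i).D.toDomains))

/-- the level of the cube block of a fine bond is the cube family's level of its initial point. [cite: Balaban1984PropagatorsII, p.231, dictionary] -/
theorem blkV1_level (f : FBondY i) : (blkV1 i.hN (cubeFamY i q) f).1.1 = levCubeY i q (B6GlobalChartV1.toBox i.hN f.src) :=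
  (B6Geom246MultiLevelBoxL0.lev_eq_of_blkOf_eq (cubeFamY i q).toDomains rfl).symm

/-- ★ **THE LEVEL WINDOW**: a fine bond seen by an index bond of level `J` lies in a cube block of level `J − 1` or `J` ([4] (2.2)–(2.4) for the cube sequence, the V1
lineage's `lev_ends_bounds`). [cite: Balaban1984PropagatorsII, (2.2)–(2.4) p.224; Balaban1984PropagatorsI, (1.18) p.20; Balaban1985BackgroundPropagators, p.409 l.3–5] -/
theorem lvl_window {ι : IBondCubeY i q} {f : FBondY i} (h : qKc i q ι f ≠ 0) :
    (ι.1.1 : ℕ) - 1 ≤ (blkV1 i.hN (cubeFamY i q) f).1.1 ∧ (blkV1 i.hN (cubeFamY i q) f).1.1 ≤ (ι.1.1 : ℕ) := by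
  obtain ⟨-, -, -, -, hRM⟩ := B9CubeBondRowAgreementNearH.side_conds i
  have h1 := B6Ineq2142KLevelV1L0.lev_ends_bounds i.hN (cubeFamY i q) i.hk hRM ι (B9CubeBondRowAgreementNearH.ends_of_qKc_ne_zero i q h)
  rw [blkV1_level]
  exact h1

/-- ★ **THE DOUBLE SUPPORT IS WITHIN `ℓ + 3` OF THE CARRIER BLOCK** (the V1 lineage's `geomT_dist_ends_le`). [cite: Balaban1984PropagatorsII, (2.46) p.231, p.247; Balaban1984PropagatorsI, (1.18) p.20] -/
theorem dist_beta_blkV1_le {ι : IBondCubeY i q} {f : FBondY i} (h : qKc i q ι f ≠ 0) :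
    (geoCK i q).dist (B6Ineq2142KLevelV1L0.β i.hN (cubeFamY i q) i.hk ι) (blkV1 i.hN (cubeFamY i q) f) ≤ (ℓ : ℝ) + 3 := by
  obtain ⟨-, -, -, -, hRM⟩ := B9CubeBondRowAgreementNearH.side_conds i
  exact B6Ineq2142KLevelV1L0.geomT_dist_ends_le i.hN (cubeFamY i q) i.hk hRM (toKT i).hMh (toKT i).hP ι (B9CubeBondRowAgreementNearH.ends_of_qKc_ne_zero i q h)

/-- ★ **TWO FINE BONDS SEEN BY A COMMON INDEX BOND ARE WITHIN `2(ℓ + 3)` IN THE BLOCK GRAPH** — the semi-locality of `P₂(A)` («depends on A, A′ restricted to j-blocks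
neighbouring the block containing the bond b»). [cite: Balaban1985BackgroundPropagators, (3.83) p.407; Balaban1984PropagatorsII, (2.46) p.231] -/
theorem dist_blkV1_le_of_common {ι : IBondCubeY i q} {f f' : FBondY i} (h : qKc i q ι f ≠ 0) (h' : qKc i q ι f' ≠ 0) :
    (geoCK i q).dist (blkV1 i.hN (cubeFamY i q) f) (blkV1 i.hN (cubeFamY i q) f') ≤ 2 * (ℓ : ℝ) + 6 := by
  obtain ⟨-, htri, -, hsym⟩ := B9CubeGeometryInputs.geoCK_dist_axioms i q 0 True
  have h1 := dist_beta_blkV1_le i q h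
  have h2 := dist_beta_blkV1_le i q h'
  rw [hsym] at h1
  have t := htri (blkV1 i.hN (cubeFamY i q) f) (B6Ineq2142KLevelV1L0.β i.hN (cubeFamY i q) i.hk ι) (blkV1 i.hN (cubeFamY i q) f')
  change (geoCK i q).dist _ _ ≤ (geoCK i q).dist _ _ + (geoCK i q).dist _ _ at t
  linarith

/-- the weight of an index bond of level `J` against the plateau and the band: `w_□(ι) ≤ b₁·(c_f∕Lᴶ)²·L^{J(d+1)}` (volume-normalised averaging kernel).
[cite: Balaban1984PropagatorsII, (2.16) p.225, (2.20) p.226, (2.90) p.239] -/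
theorem wCubeBond_le (hb₁ : b₀ ≤ b₁) (ι : IBondCubeY i q) :
    wCubeBond i q ι ≤ b₁ * (i.cf / (((ℓ + 1 : ℕ) : ℝ)) ^ (ι.1.1 : ℕ)) ^ 2 * (((ℓ + 1 : ℕ) : ℝ) ^ (d + 1)) ^ (ι.1.1 : ℕ) := by
  have h := wCubeBond_mul_plateau_le i q hb₁ ι
  have hP : (0 : ℝ) < (((ℓ + 1 : ℕ) : ℝ) ^ (d + 1)) ^ (ι.1.1 : ℕ) := by positivity
  rwa [← div_eq_mul_inv, div_le_iff₀ hP] at h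

open Classical in
/-- ★ **THE COLUMN SUM OF A FINE BOND IN A BLOCK OF LEVEL `n` IS `≤ 2L^{−n(d+1)}`**: only the levels `n`, `n + 1` see it (level window), each with total weight at most its
plateau (r05's `sum_qKc_lvl_le`). [cite: Balaban1984PropagatorsI, (1.18) p.20; Balaban1984PropagatorsII, (2.20) p.226; Balaban1985BackgroundPropagators, (3.13) p.392] -/
theorem sum_qKc_col_le_plateau (f : FBondY i) :
    ∑ ι, qKc i q ι f ≤ 2 * ((((ℓ + 1 : ℕ) : ℝ) ^ (d + 1)) ^ (blkV1 i.hN (cubeFamY i q) f).1.1)⁻¹ := by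
  set n := (blkV1 i.hN (cubeFamY i q) f).1.1 with hn
  have hmaps : ∀ ι ∈ (Finset.univ : Finset (IBondCubeY i q)), (ι.1.1 : ℕ) ∈ Finset.range (i.k + 1) :=
    fun ι _ => Finset.mem_range.2 ι.1.1.2
  rw [← Finset.sum_fiberwise_of_maps_to hmaps]
  have hL1 : (1 : ℝ) ≤ ((ℓ + 1 : ℕ) : ℝ) ^ (d + 1) := one_le_pow₀ (by exact_mod_cast Nat.succ_le_succ (Nat.zero_le ℓ))
  -- each level contributes at most its plateau, and only the levels `n`, `n+1` contribute at all
  have hlvl : ∀ J ∈ Finset.range (i.k + 1),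
      ∑ ι ∈ Finset.univ.filter (fun ι : IBondCubeY i q => (ι.1.1 : ℕ) = J), qKc i q ι f ≤
        if J = n ∨ J = n + 1 then ((((ℓ + 1 : ℕ) : ℝ) ^ (d + 1)) ^ J)⁻¹ else 0 := by
    intro J _
    split_ifs with hJ
    · exact sum_qKc_lvl_le i q J f
    · refine (Finset.sum_eq_zero fun ι hι => ?_).le
      rw [Finset.mem_filter] at hι
      by_contra hne
      have hw := lvl_window i q hne
      rw [hι.2] at hw
      omega
  refine (Finset.sum_le_sum hlvl).trans ?_
  have hsplit : ∑ J ∈ Finset.range (i.k + 1), (if J = n ∨ J = n + 1 then ((((ℓ + 1 : ℕ) : ℝ) ^ (d + 1)) ^ J)⁻¹ else 0) ≤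
      ((((ℓ + 1 : ℕ) : ℝ) ^ (d + 1)) ^ n)⁻¹ + ((((ℓ + 1 : ℕ) : ℝ) ^ (d + 1)) ^ (n + 1))⁻¹ := by
    have hsub : ∑ J ∈ Finset.range (i.k + 1), (if J = n ∨ J = n + 1 then ((((ℓ + 1 : ℕ) : ℝ) ^ (d + 1)) ^ J)⁻¹ else 0) ≤
        ∑ J ∈ ({n, n + 1} : Finset ℕ), ((((ℓ + 1 : ℕ) : ℝ) ^ (d + 1)) ^ J)⁻¹ := by
      rw [← Finset.sum_filter]
      refine Finset.sum_le_sum_of_subset_of_nonneg (fun J hJ => ?_) (fun J _ _ => by positivity)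
      rw [Finset.mem_filter] at hJ
      rcases hJ.2 with h | h <;> simp [h]
    refine hsub.trans (le_of_eq ?_)
    rw [Finset.sum_pair (by omega)]
  refine hsplit.trans ?_
  have hmono : ((((ℓ + 1 : ℕ) : ℝ) ^ (d + 1)) ^ (n + 1))⁻¹ ≤ ((((ℓ + 1 : ℕ) : ℝ) ^ (d + 1)) ^ n)⁻¹ := by
    apply inv_anti₀ (by positivity)
    rw [pow_succ]
    exact le_mul_of_one_le_right (by positivity) hL1
  linarith

end Support

/-! ## §3  The pointwise block bound of the averaging piece on product inputs `g ⊗ E` supported in one cube block -/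

section Pointwise

variable {𝔸 : Type} [NormedRing 𝔸] [NormedAlgebra ℂ 𝔸] [CompleteSpace 𝔸] [NormOneClass 𝔸]
variable (i : KIdx d ℓ hd hL b₀ b₁) (q : ↥(cubes (toKT i).D.toDomains))

/-- **THE CONSTANT OF THE AVERAGING PIECE**: `κ_av = 8·(d+2)α₁·(1 + (d+2)α₁)·b₁·L^{d+1}·e^{δ(2ℓ+6)}` (print's `O(1)α₁` of (3.83) with every factor explicit: `(d+2)α₁` is
`|Γ|·sup|ηA|` per level, `b₁L^{d+1}` the weight band against the two contributing plateaus, `e^{δ(2ℓ+6)}` the price of the exponential form over the semi-local support).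
[cite: Balaban1985BackgroundPropagators, (3.83) p.407 («O(1)α₁(Lʲη)⁻²»)] -/
def kappaAv (d ℓ : ℕ) (b₁ α₁ δ : ℝ) : ℝ :=
  8 * (((d : ℝ) + 2) * α₁) * (1 + ((d : ℝ) + 2) * α₁) * b₁ * (((ℓ + 1 : ℕ) : ℝ) ^ (d + 1)) * Real.exp (δ * (2 * (ℓ : ℝ) + 6))

/-- `κ_av ≥ 0` for `α₁, b₁ ≥ 0`. [cite: Balaban1985BackgroundPropagators, (3.83) p.407, bookkeeping] -/
theorem kappaAv_nonneg {b₁' α₁ δ : ℝ} (hb : 0 ≤ b₁') (hα : 0 ≤ α₁) : 0 ≤ kappaAv d ℓ b₁' α₁ δ := by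
  unfold kappaAv; positivity

/-- the squared length of a cube block against the band's `(c_f∕Lⁿ)²`: `(c_f∕Lⁿ)² = ((Lⁿη)²)⁻¹`. [cite: Balaban1985BackgroundPropagators, (3.41) p.397, bookkeeping] -/
theorem cf_div_pow_sq (y : BlkCubeY i q) : (i.cf / (((ℓ + 1 : ℕ) : ℝ)) ^ y.1.1) ^ 2 = ((geoCK i q).len y ^ 2)⁻¹ := by
  rw [← B9Cor35GCubeInputsAtOne.pref_eq_len_sq, B6Prop26KLevelSkeletonV1L0.pref, div_pow, div_pow, inv_div]

/-- ★★★ **(3.83) AS A BLOCK BOUND ON PRODUCT INPUTS** — the reading behind the block majorant: for a unitary-like `U′` with the level-by-level smallness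
`‖U′ − 1‖ ≤ α₁L^{−J}` within the averaging range `(d+2)(Lᴶ − 1)` of the base point of every index bond of level `J` (print's (3.37) `|A| < α₁(Lʲη)⁻¹` on the
averaging stencils, `U′ = e^{iηA}`), an input `g ⊗ E` supported in the cube block `y′` with `|g| ≤ B`, `‖E‖ ≤ 1`, and any `δ ≥ 0`:
`‖((Q*_□(U′)a_□Q_□(U′) − Q*_□(1)a_□Q_□(1))(g ⊗ E))(b)‖ ≤ κ_av·((Lⁿη)²)⁻¹·e^{−δ·d(y(b), y′)}·B`, `n` the level of the block `y(b)` of `b`.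
[cite: Balaban1985BackgroundPropagators, (3.83) p.407, (3.80)–(3.81) pp.406–407, (3.37) p.396, p.409 l.1–5; Balaban1984PropagatorsII, (2.51) p.232] -/
theorem norm_avgPiece_liftY_apply_le (hb₀ : 0 < b₀) (hb₁ : b₀ ≤ b₁) {V : CfgY 𝔸 i} (hV : ∀ μ x, UnitaryLike (V μ x)) {α₁ : ℝ} (hα₁ : 0 ≤ α₁)
    (hsm : ∀ (ι : IBondCubeY i q) (ν : Fin (d + 1)) (w : Site (PV d ℓ i.m i.K hd hL) 0),
      supDist (embIter (ι.1.1 : ℕ) ι.1.2.src) w ≤ (d + 2) * ((ℓ + 1) ^ (ι.1.1 : ℕ) - 1) →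
        ‖(V ν w : 𝔸) - 1‖ ≤ α₁ * ((((ℓ + 1 : ℕ) : ℝ)) ^ (ι.1.1 : ℕ))⁻¹)
    {δ : ℝ} (hδ : 0 ≤ δ) (g : FBondY i → ℝ) (E : 𝔸) (y' : BlkCubeY i q) {B : ℝ} (hE : ‖E‖ ≤ 1) (hB : 0 ≤ B)
    (hoff : ∀ f, blkV1 i.hN (cubeFamY i q) f ≠ y' → g f = 0) (hbd : ∀ f, |g f| ≤ B) (bb : FBondY i) :
    ‖(QsCubeY i q (parBY i) V (aCubeY i q (QCubeY i q (parBY i) V (liftY g E))) -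
        QsCubeY i q (parBY i) 1 (aCubeY i q (QCubeY i q (parBY i) 1 (liftY g E)))) bb‖ ≤
      kappaAv d ℓ b₁ α₁ δ * ((geoCK i q).len (blkV1 i.hN (cubeFamY i q) bb) ^ 2)⁻¹ *
        Real.exp (-(δ * (geoCK i q).dist (blkV1 i.hN (cubeFamY i q) bb) y')) * B := by
  set a := blkV1 i.hN (cubeFamY i q) bb with ha
  set n : ℕ := a.1.1 with hn
  set L : ℝ := ((ℓ + 1 : ℕ) : ℝ) with hLdef
  have hL1 : (1 : ℝ) ≤ L := by rw [hLdef]; exact_mod_cast Nat.succ_le_succ (Nat.zero_le ℓ)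
  have hL0 : (0 : ℝ) < L := lt_of_lt_of_le one_pos hL1
  have hb1 : 0 ≤ b₁ := hb₀.le.trans hb₁
  -- the per-index-bond data: range `(d+2)(Lᴶ − 1)`, smallness `α₁L^{−J}`, product `≤ (d+2)α₁`
  set τ : ℝ := ((d : ℝ) + 2) * α₁ with hτ
  have hτ0 : 0 ≤ τ := by positivity
  have hprod : ∀ ι : IBondCubeY i q, qsKc i q bb ι ≠ 0 →
      (((d + 2) * ((ℓ + 1) ^ (ι.1.1 : ℕ) - 1) : ℕ) : ℝ) * (α₁ * (L ^ (ι.1.1 : ℕ))⁻¹) ≤ τ := by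
    intro ι _
    have hLJ : (0 : ℝ) < L ^ (ι.1.1 : ℕ) := pow_pos hL0 _
    have h1 : (((d + 2) * ((ℓ + 1) ^ (ι.1.1 : ℕ) - 1) : ℕ) : ℝ) ≤ ((d : ℝ) + 2) * L ^ (ι.1.1 : ℕ) := by
      have : ((ℓ + 1) ^ (ι.1.1 : ℕ) - 1 : ℕ) ≤ (ℓ + 1) ^ (ι.1.1 : ℕ) := Nat.sub_le _ _
      calc (((d + 2) * ((ℓ + 1) ^ (ι.1.1 : ℕ) - 1) : ℕ) : ℝ) ≤ (((d + 2) * (ℓ + 1) ^ (ι.1.1 : ℕ) : ℕ) : ℝ) := by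
            exact_mod_cast Nat.mul_le_mul_left _ this
        _ = ((d : ℝ) + 2) * L ^ (ι.1.1 : ℕ) := by rw [hLdef]; push_cast; ring
    calc _ ≤ ((d : ℝ) + 2) * L ^ (ι.1.1 : ℕ) * (α₁ * (L ^ (ι.1.1 : ℕ))⁻¹) := mul_le_mul_of_nonneg_right h1 (by positivity)
      _ = τ := by rw [hτ]; field_simp
  -- the level-weighted amplitude bound `P` (with the locality factor built in)
  set X : ℝ := Real.exp (δ * (2 * (ℓ : ℝ) + 6)) * Real.exp (-(δ * (geoCK i q).dist a y')) with hX
  have hX0 : 0 ≤ X := by positivity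
  set P : ℝ := b₁ * (i.cf / L ^ n) ^ 2 * (L ^ (d + 1)) ^ (n + 1) * B * X with hP
  have hP0 : 0 ≤ P := by positivity
  have hA : ∀ (ι : IBondCubeY i q) (f : FBondY i), qsKc i q bb ι ≠ 0 → qKc i q ι f ≠ 0 → wCubeBond i q ι * ‖liftY g E f‖ ≤ P := by
    intro ι f hι hf
    have hι' : qKc i q ι bb ≠ 0 := by rwa [qsKc_eq_transpose, Matrix.transpose_apply] at hι
    by_cases hfy : blkV1 i.hN (cubeFamY i q) f = y'
    · -- the two fine bonds share `ι`: level window at both, block distance `≤ 2ℓ + 6`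
      have hwb := lvl_window i q hι'
      rw [← ha] at hwb
      have hdist : (geoCK i q).dist a y' ≤ 2 * (ℓ : ℝ) + 6 := by rw [← hfy]; exact dist_blkV1_le_of_common i q hι' hf
      have hX1 : 1 ≤ X := by
        rw [hX, ← Real.exp_add]
        exact Real.one_le_exp (by nlinarith)
      have hnorm : ‖liftY g E f‖ ≤ B := by
        rw [liftY_apply, norm_smul, Complex.norm_real, Real.norm_eq_abs]
        calc |g f| * ‖E‖ ≤ B * 1 := mul_le_mul (hbd f) hE (norm_nonneg _) hB
          _ = B := mul_one B
      have hw := wCubeBond_le i q hb₁ ι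
      -- `w_□(ι) ≤ b₁ (c_f/Lⁿ)² (L^{d+1})^{n+1}` from `n ≤ J ≤ n + 1`
      have hJ1 : n ≤ (ι.1.1 : ℕ) := hwb.2
      have hJ2 : (ι.1.1 : ℕ) ≤ n + 1 := by omega
      have hsq : (i.cf / L ^ (ι.1.1 : ℕ)) ^ 2 ≤ (i.cf / L ^ n) ^ 2 := by
        rw [div_pow, div_pow]
        exact div_le_div_of_nonneg_left (sq_nonneg _) (by positivity) (pow_le_pow_left₀ (by positivity) (pow_le_pow_right₀ hL1 hJ1) 2)
      have hpl : (L ^ (d + 1)) ^ (ι.1.1 : ℕ) ≤ (L ^ (d + 1)) ^ (n + 1) := pow_le_pow_right₀ (one_le_pow₀ hL1) hJ2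
      have hw' : wCubeBond i q ι ≤ b₁ * (i.cf / L ^ n) ^ 2 * (L ^ (d + 1)) ^ (n + 1) := by
        refine hw.trans ?_
        exact mul_le_mul (mul_le_mul_of_nonneg_left hsq hb1) hpl (by positivity) (by positivity)
      calc wCubeBond i q ι * ‖liftY g E f‖ ≤ b₁ * (i.cf / L ^ n) ^ 2 * (L ^ (d + 1)) ^ (n + 1) * B :=
            mul_le_mul hw' hnorm (norm_nonneg _) (by positivity)
        _ = b₁ * (i.cf / L ^ n) ^ 2 * (L ^ (d + 1)) ^ (n + 1) * B * 1 := (mul_one _).symm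
        _ ≤ P := by rw [hP]; exact mul_le_mul_of_nonneg_left hX1 (by positivity)
    · rw [liftY_apply, hoff f hfy, Complex.ofReal_zero, zero_smul, norm_zero, mul_zero]
      exact hP0
  -- r05's (3.83), per-index-bond form, at background `1`
  have hmain := norm_QsaQCubeY_sub_one_apply_le_at i q hb₀ hV (ρ := fun ι => α₁ * (L ^ (ι.1.1 : ℕ))⁻¹) (fun ι => by positivity)
    (Da := fun ι => (d + 2) * ((ℓ + 1) ^ (ι.1.1 : ℕ) - 1)) hτ0 (fun ι b' hb' => tdist_of_qKc_ne_zero i q hb') bb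
    (fun ι _ ν w hw => hsm ι ν w hw) hprod (liftY g E) hA
  refine hmain.trans ?_
  -- the column sum against the two plateaus
  have hcol : ∑ ι, |qsKc i q bb ι| ≤ 2 * ((L ^ (d + 1)) ^ n)⁻¹ := by
    have e : ∑ ι, |qsKc i q bb ι| = ∑ ι, qKc i q ι bb :=
      Finset.sum_congr rfl fun ι _ => by rw [qsKc_eq_transpose, Matrix.transpose_apply, abs_of_nonneg (qKc_nonneg i q ι bb)]
    rw [e]
    exact sum_qKc_col_le_plateau i q bb
  have hlen : (i.cf / L ^ n) ^ 2 = ((geoCK i q).len a ^ 2)⁻¹ := cf_div_pow_sq i q a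
  calc 4 * τ * (1 + τ) * P * ∑ ι, |qsKc i q bb ι| ≤ 4 * τ * (1 + τ) * P * (2 * ((L ^ (d + 1)) ^ n)⁻¹) :=
        mul_le_mul_of_nonneg_left hcol (by positivity)
    _ = kappaAv d ℓ b₁ α₁ δ * ((geoCK i q).len a ^ 2)⁻¹ * Real.exp (-(δ * (geoCK i q).dist a y')) * B := by
        rw [hP, hX, kappaAv, ← hlen, ← hLdef, hτ, pow_succ]
        have hLn : (L ^ (d + 1)) ^ n ≠ 0 := by positivity
        field_simp
        ring

end Pointwise

/-! ## §4  ★★★ The block majorant of the realified averaging piece — the `hP₂` input of r06's `ineq385_op` at r05's cube letters -/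

section Majorant

variable {𝔸 : Type} [NormedRing 𝔸] [NormedAlgebra ℂ 𝔸] [CompleteSpace 𝔸] [NormOneClass 𝔸]
variable {ιb : Type} [Fintype ιb] (b : Module.Basis ιb ℝ 𝔸)
variable (i : KIdx d ℓ hd hL b₀ b₁) (q : ↥(cubes (toKT i).D.toDomains))

/-- **the realified averaging piece** `conj b(Q*_□(1)a_□Q_□(1) − Q*_□(U′)a_□Q_□(U′))` of the (3.84) remainder `V = Δ_{a,□}(1) − Δ_{a,□}(U′)` (def-Y's taxicab transporters).
[cite: Balaban1985BackgroundPropagators, (3.82)–(3.84) p.407, (3.26) p.395] -/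
def avgPieceK (V : CfgY 𝔸 i) : Module.End ℝ (FBondY i × ιb → ℝ) :=
  B9Eq352DivFormLetters.conj b
    ((QsCubeY i q (parBY i) 1 ∘ₗ aCubeY i q ∘ₗ QCubeY i q (parBY i) 1 - QsCubeY i q (parBY i) V ∘ₗ aCubeY i q ∘ₗ QCubeY i q (parBY i) V).restrictScalars ℝ)

/-- ★★★ **THE BLOCK MAJORANT OF THE AVERAGING PIECE** ((3.83) in [4]'s (2.51) currency over the cube sequence's blocks, real coordinates): under the level-by-level
smallness of `U′` on the averaging stencils (`‖U′ − 1‖ ≤ α₁L^{−J}` within `(d+2)(Lᴶ − 1)` of every level-`J` base point) and for every `δ ≥ 0`,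
`conj b(Q*_□(1)a_□Q_□(1) − Q*_□(U′)a_□Q_□(U′)) ≺ (M₂Σ_j‖b_j‖)·κ_av·((Lⁿη)²)⁻¹·e^{−δd}` over `toB6 (geoCK i □) Rr H` with the bond block map `blkBK` — the `P₂`-SHAPED
input `κ₂α₁(len)⁻²e^{−δd}` of r06's `B9Ineq385VG.ineq385_op` (n06-c's `hasMajorant_conj_of_liftY_bound` on §3).
[cite: Balaban1985BackgroundPropagators, (3.83) p.407, (3.85) p.407, p.409 l.1–5; Balaban1984PropagatorsII, (2.51) p.232] -/
theorem hasMajorant_avgPieceK (hb₀ : 0 < b₀) (hb₁ : b₀ ≤ b₁) {M₂ : ℝ} (hM₂ : 0 ≤ M₂) (hrepr : ∀ (v : 𝔸) (j : ιb), |b.repr v j| ≤ M₂ * ‖v‖)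
    {V : CfgY 𝔸 i} (hV : ∀ μ x, UnitaryLike (V μ x)) {α₁ : ℝ} (hα₁ : 0 ≤ α₁)
    (hsm : ∀ (ι : IBondCubeY i q) (ν : Fin (d + 1)) (w : Site (PV d ℓ i.m i.K hd hL) 0),
      supDist (embIter (ι.1.1 : ℕ) ι.1.2.src) w ≤ (d + 2) * ((ℓ + 1) ^ (ι.1.1 : ℕ) - 1) →
        ‖(V ν w : 𝔸) - 1‖ ≤ α₁ * ((((ℓ + 1 : ℕ) : ℝ)) ^ (ι.1.1 : ℕ))⁻¹)
    {δ : ℝ} (hδ : 0 ≤ δ) (Rr : ℝ) (H : Prop) :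
    B6RandomWalk.HasMajorant (g := B9Thm34Ext.toB6 (geoCK i q) Rr H) (B9Cor35GCubeInputsAtOne.blkBK i q) (avgPieceK b i q V)
      (fun a a' => (M₂ * ∑ j, ‖b j‖) * (kappaAv d ℓ b₁ α₁ δ * ((geoCK i q).len a ^ 2)⁻¹ * Real.exp (-(δ * (geoCK i q).dist a a')))) := by
  refine B9SectBGpReadingsY.hasMajorant_conj_of_liftY_bound b (g := B9Thm34Ext.toB6 (geoCK i q) Rr H) (fun f : FBondY i => blkV1 i.hN (cubeFamY i q) f) _ _
    M₂ hM₂ hrepr fun g E y' B hE hB hoff hbd bb => ?_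
  have h := norm_avgPiece_liftY_apply_le i q hb₀ hb₁ hV hα₁ hsm hδ g E y' hE hB hoff hbd bb
  rw [LinearMap.restrictScalars_apply, LinearMap.sub_apply, LinearMap.comp_apply, LinearMap.comp_apply, LinearMap.comp_apply, LinearMap.comp_apply,
    ← neg_sub, Pi.neg_apply, norm_neg]
  exact h

end Majorant

end Literature.MathematicalPhysics.QuantumFieldTheory.Balaban1983to89.B9Cor35GCubeAvgPiece

end
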